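import Summits.BirchSwinnertonDyer.BirchSwinnertonDyer.Theses.KolyvaginRankRigidityAtTwo
import HarnessLib

/-!
# Crux V1′ `KolyvaginNonvanishingAtTwoFrame` (stmt-BirchSwinnertonDyer-24622) and its registered stub
# `stub_torsionLevelOne` FROM Kolyvagin's Conjecture A at 2 ALONE (U1 `KolyvaginBoundedDefectAtTwo`, stmt-28083)
# — route `KolyvaginRankRigidityAtTwo`; the print fact Gross 1991 Prop. 3.7 (2) leaves V1′'s conditional register

Seat `leafhand-bsd-kolyvaginrankrigid-1` g0 (prover; `--supports stmt-BirchSwinnertonDyer-24622`, helper; THEOREMS ONLY, no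
definition, no named fact).  The tree's conditional closure of V1′ is
`TwoAdicConverseOfConjA.kolyvaginNonvanishingAtTwoFrame_of_conjA_of_prop37 (hU1) (h37)` (p648629, LEAD krr2-p1 g12: U1 ⇒ U2
(from Prop. 3.7 (2)) ⇒ V1′∞ ⇒ V1′, stated on route `TwoAdicConverse`'s twin decl).  The hypothesis `h37` is idle for THIS
consequence: U1 gives, for the universal frame, a depth `r`, a defect bound `m` and at EVERY level `M > m` a Kolyvagin
conductor `n` of depth `r` with `M ≤ M(n)` and `2^(M−m−1)·c_M(n) ≠ 0`; at the single level `M := m + 1` this reads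
`c_{m+1}(n) ≠ 0` with `1 ≤ m + 1 ≤ M(n)` — which is V1′ verbatim.  So on THIS route's decls:

* `kolyvaginNonvanishingAtTwoFrame_of_boundedDefect : KolyvaginBoundedDefectAtTwo → KolyvaginNonvanishingAtTwoFrame`
  (V1′ 24622 ⇐ U1 28083, no print fact);
* `stub_torsionLevelOne_of_boundedDefect` — the registered stub `stub_torsionLevelOne` of the skeleton `level_one_split`
  (its signature character for character) from U1 (its extra hypothesis «every `P(1)` torsion» is not needed);
* `kolyvaginNonvanishingAtTwoFrame_of_nonvanishingAtTwoFrameTheta` (V1′ ⇐ V1′θ 27219, instance `θ = 1, k = 0`) and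
  `kolyvaginNonvanishingAtTwoFrame_of_strongNonzeroSystem` (V1′ ⇐ V1′∞ 27983, instance `θ = 1, k = 0`) — the two by-name
  links the route file lacks on its own decls (the tree has them only on `TwoAdicConverse`'s twins).

READING: on route `KolyvaginRankRigidityAtTwo` the non-vanishing family is linearly ordered in the kernel
V1′ ⇐ V1′θ ⇐ V1′∞ ⇐ U1 (the last link is `KolyvaginAtTwo.KolyvaginSwap.strongNonzeroSystem_of_boundedDefect`, krr2-p2 g22);
this file adds the bottom links, so the conditional register of V1′ (24622) is {U1 28083} and NOT {U1, Gross 3.7 (2)}.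
HONEST FRAMING: U1 (Kolyvagin's Conjecture A at `p = 2` with bounded defect on `y_K`-torsion frames) is OPEN in print
(W. Zhang 2014 Thm. 1.1 needs `p ≥ 5`); these are implications between open statements; `stub_torsionLevelOne` is NOT
closed; V1′ is NOT proved; the Birch–Swinnerton-Dyer conjecture is NOT proved by this.
References (locators only): [cite: Kolyvagin1991MathAnn, §2 (2.1), Conj. A / Conj. 2.5] [cite: WZhang2014, Thm. 1.1 (p ≥ 5)]
[cite: GrossLMS1991, Prop. 3.7 (2) (the print fact NOT used here)].
Design: no definitions; default heartbeats; axioms `propext`, `Classical.choice`, `Quot.sound`.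
-/

set_option autoImplicit false
-- the Theorems namespace of this sub repeats the summit name by design (D-0017 nested layout)
set_option linter.dupNamespace false

noncomputable section

open scoped Classical

open Literature.NumberTheory.EllipticCurves
open Summit.BirchSwinnertonDyer.BirchSwinnertonDyer.Theses.KolyvaginRankRigidityAtTwo

namespace Summit.BirchSwinnertonDyer.BirchSwinnertonDyer.Theorems.KolyvaginAtTwo

/-- **V1′ ⇐ U1 (no print fact)**: Kolyvagin's Conjecture A at `2` in bounded-defect form (`KolyvaginBoundedDefectAtTwo`,
stmt-28083) implies the crux V1′ `KolyvaginNonvanishingAtTwoFrame` (stmt-24622) on the same universal frame — take the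
single level `M := m + 1`, where `2^(M−m−1)·c_M(n) = c_M(n) ≠ 0` and `1 ≤ M ≤ M(n)`.  Both sides OPEN; BSD is not proved.
[cite: Kolyvagin1991MathAnn, §2 (2.1), Conj. A] -/
theorem kolyvaginNonvanishingAtTwoFrame_of_boundedDefect (hU1 : KolyvaginBoundedDefectAtTwo) :
    KolyvaginNonvanishingAtTwoFrame := by
  unfold KolyvaginNonvanishingAtTwoFrame
  intro W _ _ hCM hred hsur K _ _ hK _ hHN hodd hne3 htor hH2 Dt β ι hβ
  obtain ⟨r, m, hm⟩ := hU1 W hCM hred hsur K hK hHN hodd hne3 htor hH2 Dt β ι hβ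
  obtain ⟨n, d, hn, -, hlev, hne⟩ := hm (m + 1) (Nat.lt_succ_self m)
  refine ⟨n, d, m + 1, hn, Nat.succ_pos m, hlev, ?_⟩
  rwa [show m + 1 - m - 1 = 0 from by omega, pow_zero, one_zsmul] at hne

/-- **The registered stub `stub_torsionLevelOne` of V1′'s skeleton `level_one_split` (stmt-24622) from U1** — its
signature character for character (the level-one torsion hypothesis `∀ d₁, IsOfFinAddOrder d₁.derivedPoint` is carried
and not used: U1 already produces a non-zero class on the whole frame).  CONDITIONAL on the open U1; the stub is NOT
closed by this. [cite: Kolyvagin1991MathAnn, §2 Conj. A] [cite: WZhang2014, Thm. 1.1 (p ≥ 5)] -/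
theorem stub_torsionLevelOne_of_boundedDefect (hU1 : KolyvaginBoundedDefectAtTwo) :
    ∀ (W : WeierstrassCurve ℚ) [W.IsElliptic] [W.IsGloballyMinimal], ¬ W.HasCM →
      (Literature.NumberTheory.EllipticCurves.Rank1Residual.GoodOrd W 2 ∨
      Literature.NumberTheory.EllipticCurves.Rank1Residual.Mult W 2) → (∀ m : ℕ,
      W.HasSurjectiveModNGaloisRep (2 ^ m : ℕ)) → ∀ (K : Type) [Field K] [NumberField K],
      Literature.NumberTheory.EllipticCurves.IsImaginaryQuadratic K → ∀ [NeZero (W.conductorNorm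
      ℤ)], Literature.NumberTheory.EllipticCurves.SatisfiesHeegnerHypothesis (W.conductorNorm ℤ) K →
      Odd (NumberField.discr K) → NumberField.discr K ≠ -3 → AddSubgroup.torsionBy (W.baseChange
      K).toAffine.Point (2 : ℤ) = ⊥ →
      Literature.NumberTheory.EllipticCurves.SatisfiesHeegnerHypothesis 2 K → ∀ (Dt :
      Literature.NumberTheory.EllipticCurves.ModularForms.ModularParametrizationData W
      (W.conductorNorm ℤ)) (β : ℤ) (ι : K →+* ℂ), (4 * (W.conductorNorm ℤ : ℤ)) ∣ β ^ 2 -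
      NumberField.discr K → (∀ d₁ : Literature.NumberTheory.EllipticCurves.KolyvaginHeegnerData Dt β
      ι 1, IsOfFinAddOrder d₁.derivedPoint) → ∃ (n : ℕ) (d :
      Literature.NumberTheory.EllipticCurves.KolyvaginHeegnerData Dt β ι n) (M : ℕ),
      Literature.NumberTheory.EllipticCurves.KolyvaginDescent.KolSupp
      (Literature.NumberTheory.EllipticCurves.Zhang2014.IsKolyvaginPrime (W.conductorNorm ℤ) W K 2)
      n ∧ 1 ≤ M ∧ (M : ℕ∞) ≤ Literature.NumberTheory.EllipticCurves.Zhang2014.levelIndex W 2 n ∧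
      d.kolyvaginClass Nat.prime_two M ≠ 0 := by
  intro W _ _ hCM hred hsur K _ _ hK _ hHN hodd hne3 htor hH2 Dt β ι hβ _
  exact kolyvaginNonvanishingAtTwoFrame_of_boundedDefect hU1 W hCM hred hsur K hK hHN hodd hne3 htor hH2 Dt β ι hβ

/-- **V1′ ⇐ V1′θ** (stmt-24622 ⇐ stmt-27219): the relative-margin form at `θ = 1, k = 0`. Both OPEN; BSD is not proved.
[cite: Kolyvagin1991MathAnn, §2 (2.1)] -/
theorem kolyvaginNonvanishingAtTwoFrame_of_nonvanishingAtTwoFrameTheta (hθ : KolyvaginNonvanishingAtTwoFrameTheta) :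
    KolyvaginNonvanishingAtTwoFrame := by
  unfold KolyvaginNonvanishingAtTwoFrame
  intro W _ _ hCM hred hsur K _ _ hK _ hHN hodd hne3 htor hH2 Dt β ι hβ
  obtain ⟨n, d, M, hn, hM, hle, hne⟩ := hθ W hCM hred hsur K hK hHN hodd hne3 htor hH2 Dt β ι hβ 1 0
  exact ⟨n, d, M, hn, hM, by simpa using hle, hne⟩

/-- **V1′ ⇐ V1′∞** (stmt-24622 ⇐ stmt-27983): the strong non-zero system at `θ = 1, k = 0`. Both OPEN; BSD is not proved.
[cite: Kolyvagin1991MathAnn, §2 (2.1), Conj. 2.5] -/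
theorem kolyvaginNonvanishingAtTwoFrame_of_strongNonzeroSystem (hV1 : KolyvaginStrongNonzeroSystemAtTwo) :
    KolyvaginNonvanishingAtTwoFrame := by
  unfold KolyvaginNonvanishingAtTwoFrame
  intro W _ _ hCM hred hsur K _ _ hK _ hHN hodd hne3 htor hH2 Dt β ι hβ
  obtain ⟨r, hr⟩ := hV1 W hCM hred hsur K hK hHN hodd hne3 htor hH2 Dt β ι hβ
  obtain ⟨n, d, M, hn, -, hM, hle, hne⟩ := hr 1 0
  exact ⟨n, d, M, hn, hM, by simpa using hle, hne⟩

end Summit.BirchSwinnertonDyer.BirchSwinnertonDyer.Theorems.KolyvaginAtTwo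

end
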